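import Literature.AnabelianGeometry.EtaleTheta.Discharge.Sec1Rmk164ContH1ComapAlongCompletion
import Literature.AnabelianGeometry.EtaleTheta.Discharge.Sec1Rmk164ProfiniteCompletionRestrictCofinal
import Literature.AnabelianGeometry.EtaleTheta.ThetaSettingHatTheta
import Literature.AnabelianGeometry.EtaleTheta.ContH1ActionCongr
import HarnessLib

/-!
# Continuous `H¹` of a tempered fundamental group with profinite coefficients equals that of its
# profinite completion — the hypothesis-free full-group case ([EtTh] Rmk 1.6.4 «profinite versions»)

Mochizuki, *The étale theta function and its Frobenioid-theoretic manifestations*, Publ. RIMS **45**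
(2009) [EtTh], §1 p. 238 ("Write `Π_X := (Π^tp_X)^∧` for the profinite completion of `Π^tp_X`") and
Remark 1.6.4 p. 252 ("there are [easier] profinite versions of the constructions given in the present §1 …
determines, by profinite completion, a set of classes") [cite: MochizukiEtTh2009, Rmk 1.6.4 p.252]; the
cohomology is Neukirch–Schmidt–Wingberg I §2 / II §7 [cite: NeukirchSchmidtWingberg2008, I §2 and II §7] in the
tree's carrier `ContH1`; the completion is [SemiAnbd] §6 [cite: MochizukiSemiAnbd2006, §6 p.69].

PROOF-ONLY (abc-iut cell, prover abc-iut-f-128 gen 8, self-named S item «TEMPERED-VS-PROFINITE H¹ @ FULL GROUP»;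
no definitions, no facts).  The FULL-GROUP instance of abc-iut p503502
`ContH1.comap_bijective_of_isProfiniteCompletion`, where the cofinality clause of the subgroup case is automatic
(`IsProfiniteCompletion.cofinal_of_isOpen_of_finiteIndex ⊤`, abc-iut-f-142) and «`toHat` is a profinite
completion» is a FIELD of the tree's `TemperedCurve` record — so NOTHING is displayed:
* `TemperedCurve.comap_toHat_bijective_top` — for EVERY `X : TemperedCurve p`, every continuous homomorphism
  `φ̂ : Π_X → Ĝ′` into a profinite group and every closed abelian normal `A ⊴ Ĝ′`, pull-back along
  `toHat : Π^tp_X → Π_X` is a BIJECTION `H¹(Π_X, A) → H¹(Π^tp_X, A)` (continuous crossed homomorphisms modulo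
  principal ones, the actions through `φ̂`, resp. `φ̂ ∘ toHat`); `…_injective_top` needs only `Ĝ′` Hausdorff;
* `ThetaSetting.HatTheta.comap_toHat_bijective_top` — at abc-iut-f-142's profinite Θ-quotient record (`D : ThetaSetting p`,
  `T : D.HatTheta`): `H¹(Π_X, ι(Δ_Θ)) = T.H1Hat ⊤ → H¹(Π^tp_X, ι(Δ_Θ))` is a bijection — the «profinite version» of the
  §1 cohomology at the full group, with NO displayed input (contrast the `Π^tp_Ÿ`-level, where the intrinsic
  completion fails — `…RestrictNoGo.lean` — and the route runs through the Θ-quotient, `…ThetaLevelCompletion.lean`).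
Classical; nothing here bears on [IUTchIII] Cor. 3.12; typed ≠ proved.
-/

noncomputable section

open scoped IsMulCommutative
open Topology

/-! ### §1. Every tempered curve: `H¹(Π_X, A) ≅ H¹(Π^tp_X, A)` for profinite coefficients -/

namespace Literature.AnabelianGeometry.SemiGraphs

namespace TemperedCurve

open Literature.AnabelianGeometry.EtaleTheta

variable {p : ℕ} [Fact p.Prime] (X : TemperedCurve p)

/-- The closure of `toHat(Π^tp_X)` in `Π_X` is everything (`toHat` has dense range).
[cite: MochizukiSemiAnbd2006, §6 p.69] -/
theorem topologicalClosure_map_toHat_top :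
    ((⊤ : Subgroup X.PiTemp).map X.toHat.toMonoidHom).topologicalClosure = ⊤ := by
  apply SetLike.coe_injective
  rw [Subgroup.topologicalClosure_coe, Subgroup.coe_map, Subgroup.coe_top, Subgroup.coe_top,
    Set.image_univ]
  exact X.isProfiniteCompletion_toHat.denseRange.closure_range

/-- **The co-restriction `Π^tp_X = ⊤ → ⊤ = Π_X` of `toHat` is a profinite completion** (the record field
`isProfiniteCompletion_toHat`, re-read on the top subgroups; cofinality is automatic for the finite-index open
subgroup `⊤`, abc-iut-f-142's `cofinal_of_isOpen_of_finiteIndex`). [cite: MochizukiSemiAnbd2006, §6 p.69] -/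
theorem exists_isProfiniteCompletion_toHat_top :
    ∃ κ : (⊤ : Subgroup X.PiTemp) →ₜ* (⊤ : Subgroup X.PiHat),
      (∀ y : (⊤ : Subgroup X.PiTemp), ((κ y : (⊤ : Subgroup X.PiHat)) : X.PiHat) = X.toHat (y : X.PiTemp)) ∧
      IsProfiniteCompletion κ := by
  let κ : (⊤ : Subgroup X.PiTemp) →ₜ* (⊤ : Subgroup X.PiHat) :=
    { toMonoidHom := (X.toHat.toMonoidHom.comp (⊤ : Subgroup X.PiTemp).subtype).codRestrict _ fun _ =>
        Subgroup.mem_top _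
      continuous_toFun := (X.toHat.continuous.comp continuous_subtype_val).subtype_mk _ }
  have hopen : IsOpen (((⊤ : Subgroup X.PiTemp)) : Set X.PiTemp) := by
    rw [Subgroup.coe_top]; exact isOpen_univ
  refine ⟨κ, fun _ => rfl, ?_⟩
  exact IsProfiniteCompletion.restrict_of_cofinal X.isProfiniteCompletion_toHat ⊤
    (IsProfiniteCompletion.cofinal_of_isOpen_of_finiteIndex ⊤ hopen) ⊤
    X.topologicalClosure_map_toHat_top.symm κ fun _ => rfl

variable {Gh' : Type*} [Group Gh'] [TopologicalSpace Gh'] [IsTopologicalGroup Gh']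

/-- **Pull-back `H¹(Π_X, A) → H¹(Π^tp_X, A)` along `toHat` is injective** for every tempered curve, every
continuous action `φ̂ : Π_X → Ĝ′` on a Hausdorff group and every abelian normal `A ⊴ Ĝ′` (dense range of
`toHat`; abc-iut p503502 `ContH1.comap_injective_of_dense`). [cite: MochizukiEtTh2009, Rmk 1.6.4 p.252]
[cite: NeukirchSchmidtWingberg2008, I §2 and II §7] -/
theorem comap_toHat_injective_top [T2Space Gh'] (φh : X.PiHat →* Gh') (hφh : Continuous φh)
    (A : Subgroup Gh') [A.Normal] [IsMulCommutative A] :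
    Function.Injective (ContH1.comap φh A X.toHat.toMonoidHom X.toHat.continuous
      (le_top : (⊤ : Subgroup X.PiTemp).map X.toHat.toMonoidHom ≤ ⊤) :
        ContH1 φh A (⊤ : Subgroup X.PiHat) → ContH1 (φh.comp X.toHat.toMonoidHom) A (⊤ : Subgroup X.PiTemp)) := by
  refine ContH1.comap_injective_of_dense φh hφh A X.toHat.toMonoidHom X.toHat.continuous _ ?_
  obtain ⟨κ, hκ, hc⟩ := X.exists_isProfiniteCompletion_toHat_top
  have hr : Set.range κ =
      (Subtype.val : (⊤ : Subgroup X.PiHat) → X.PiHat) ⁻¹' (X.toHat.toMonoidHom '' ((⊤ : Subgroup X.PiTemp) : Set X.PiTemp)) := by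
    ext w
    constructor
    · rintro ⟨y, rfl⟩
      exact ⟨y, y.2, (hκ y).symm⟩
    · rintro ⟨z, hz, hzw⟩
      refine ⟨⟨z, hz⟩, Subtype.ext ?_⟩
      rw [hκ]; exact hzw
  rw [← hr]
  exact hc.denseRange

/-- **`H¹(Π_X, A) ≅ H¹(Π^tp_X, A)` for profinite coefficients, for EVERY tempered curve** — the continuous `H¹`
(crossed homomorphisms) of the tempered fundamental group with coefficients in a closed abelian normal subgroup
`A` of a profinite group `Ĝ′` acted on through a continuous `φ̂ : Π_X → Ĝ′` is carried bijectively from the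
profinite completion by pull-back along `toHat`; NO displayed hypothesis (abc-iut p503502 at the full group, where
the profinite-completion input is the record field `isProfiniteCompletion_toHat`). "Profinite versions of the
constructions of §1", [EtTh] Rmk. 1.6.4. [cite: MochizukiEtTh2009, Rmk 1.6.4 p.252]
[cite: NeukirchSchmidtWingberg2008, I §2 and II §7] -/
theorem comap_toHat_bijective_top [CompactSpace Gh'] [T2Space Gh'] [TotallyDisconnectedSpace Gh']
    (φh : X.PiHat →* Gh') (hφh : Continuous φh) (A : Subgroup Gh') [A.Normal] [IsMulCommutative A]
    (hA : IsClosed (A : Set Gh')) :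
    Function.Bijective (ContH1.comap φh A X.toHat.toMonoidHom X.toHat.continuous
      (le_top : (⊤ : Subgroup X.PiTemp).map X.toHat.toMonoidHom ≤ ⊤) :
        ContH1 φh A (⊤ : Subgroup X.PiHat) → ContH1 (φh.comp X.toHat.toMonoidHom) A (⊤ : Subgroup X.PiTemp)) := by
  obtain ⟨κ, hκ, hc⟩ := X.exists_isProfiniteCompletion_toHat_top
  exact ContH1.comap_bijective_of_isProfiniteCompletion hφh hA X.toHat.continuous le_top hκ hc

/-- The `∃!`-form: every continuous `H¹`-class of `Π^tp_X` with profinite coefficients is the pull-back of a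
UNIQUE class of `Π_X`. [cite: MochizukiEtTh2009, Rmk 1.6.4 p.252] -/
theorem existsUnique_comap_toHat_eq_top [CompactSpace Gh'] [T2Space Gh'] [TotallyDisconnectedSpace Gh']
    (φh : X.PiHat →* Gh') (hφh : Continuous φh) (A : Subgroup Gh') [A.Normal] [IsMulCommutative A]
    (hA : IsClosed (A : Set Gh')) (x : ContH1 (φh.comp X.toHat.toMonoidHom) A (⊤ : Subgroup X.PiTemp)) :
    ∃! xh : ContH1 φh A (⊤ : Subgroup X.PiHat),
      ContH1.comap φh A X.toHat.toMonoidHom X.toHat.continuous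
        (le_top : (⊤ : Subgroup X.PiTemp).map X.toHat.toMonoidHom ≤ ⊤) xh = x :=
  (X.comap_toHat_bijective_top φh hφh A hA).existsUnique x

end TemperedCurve

end Literature.AnabelianGeometry.SemiGraphs

/-! ### §2. At the profinite Θ-quotient record: `H¹(Π_X, Δ_Θ) ≅ H¹(Π^tp_X, ι(Δ_Θ))` -/

namespace Literature.AnabelianGeometry.EtaleTheta

namespace ThetaSetting

namespace HatTheta

open Literature.AnabelianGeometry.SemiGraphs

variable {p : ℕ} [Fact p.Prime] {D : ThetaSetting p} (T : D.HatTheta)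

/-- **The «profinite version» of the §1 cohomology at the full group, hypothesis-free at the record**: for
`D : ThetaSetting p` and abc-iut-f-142's profinite Θ-quotient record `T : D.HatTheta`, pull-back along `toHat` is a
bijection `H¹(Π_X, Δ_Θ) = T.H1Hat ⊤ → H¹(Π^tp_X, ι(Δ_Θ))` (action through `toThetaHat ∘ toHat`; `ι(Δ_Θ)` is closed
by the record, `((Π^tp_X)^Θ)^∧` is profinite). [cite: MochizukiEtTh2009, Rmk 1.6.4 p.252]
[cite: NeukirchSchmidtWingberg2008, I §2 and II §7] -/
theorem comap_toHat_bijective_top [T.DeltaThetaHat.Normal] :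
    Function.Bijective (ContH1.comap T.toThetaHat.toMonoidHom T.DeltaThetaHat D.toHat.toMonoidHom
      D.toHat.continuous (le_top : (⊤ : Subgroup D.PiTemp).map D.toHat.toMonoidHom ≤ ⊤) :
        T.H1Hat ⊤ → ContH1 (T.toThetaHat.toMonoidHom.comp D.toHat.toMonoidHom) T.DeltaThetaHat
          (⊤ : Subgroup D.PiTemp)) :=
  D.toTemperedCurve.comap_toHat_bijective_top T.toThetaHat.toMonoidHom T.toThetaHat.continuous
    T.DeltaThetaHat T.isClosed_deltaThetaHat

/-- The same read through the TEMPERED Θ-quotient action `ι ∘ toTheta` (equal to `toThetaHat ∘ toHat` by the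
record's square `ι_toTheta`), via the identity-on-cocycles transport `ContH1.actionCongr`: every class of
`H¹(Π^tp_X, ι(Δ_Θ))` for the action through `(Π^tp_X)^Θ` is, after transport, the pull-back of a unique class of
`H¹(Π_X, Δ_Θ)`. [cite: MochizukiEtTh2009, Rmk 1.6.4 p.252] -/
theorem existsUnique_comap_toHat_eq_actionCongr_top [T.DeltaThetaHat.Normal]
    (x : ContH1 (((MonoidHom.id T.GhatTheta).comp T.ι.toMonoidHom).comp D.toTheta) T.DeltaThetaHat
      (⊤ : Subgroup D.PiTemp)) :
    ∃! xh : T.H1Hat ⊤,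
      ContH1.comap T.toThetaHat.toMonoidHom T.DeltaThetaHat D.toHat.toMonoidHom D.toHat.continuous
          (le_top : (⊤ : Subgroup D.PiTemp).map D.toHat.toMonoidHom ≤ ⊤) xh =
        ContH1.actionCongr (H := (⊤ : Subgroup D.PiTemp))
          (fun g _ a => by
            have h : (((MonoidHom.id T.GhatTheta).comp T.ι.toMonoidHom).comp D.toTheta) g =
                (T.toThetaHat.toMonoidHom.comp D.toHat.toMonoidHom) g := T.ι_toTheta g
            rw [h]) x :=
  (T.comap_toHat_bijective_top).existsUnique _

end HatTheta

end ThetaSetting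

end Literature.AnabelianGeometry.EtaleTheta

end
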